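import Mathlib
import HarnessLib
import Summits.HubbardSuperconductivity.HubbardSuperconductivity.Theorems.KLProgrammeKLRegimeVolumeLimitV9GluedSrcPairDoorAt

/-!
# Route `KLProgramme` — crux K3, VL child `KLRegimeVolumeLimitV17F2` (stmt-HubbardSuperconductivity-20440): THE END DOORS RE-KEYED TO THE v10 PRODUCER
# STATEMENT (`SourceProfilesAtLev … j j (j+1)`, the (R75f)(a) sub-diagonal read-out) (seat hubbard-kl-k3c4-p1 g14, for the v10 registration asked by
# plan g22 (R149); `--supports` 20440)

k3c5-p3's END doors `…VolumeLimitV9GluedSrcPairDoor.stub_vl_nestedFramed_of_gluedSrcDefect` (k3c5-p3) and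
`…VolumeLimitV9GluedSrcPairDoorAt.stub_vl_nestedFramed_of_gluedSrcDefect_keyedAt` (p589727) carry the v9 producer statement
(`∀ j ≤ n⋆, SourceProfilesAt … j`) as antecedent and use it in exactly ONE place per volume: the far-row datum
`klSrcPinnedSum … n⋆ 2 2 0 ((of,(0,0,0)),1) ≤ A n⋆ 2` (`klSrcPinnedSum_two_two_le_of_sourceProfilesAt`).  Skeleton «cauchy» v10 re-keys the producer
stub to E1's sub-diagonal read-out `∀ j, j+1 ≤ n⋆ → SourceProfilesAtLev … (klSrcBudget … (j+1)) … j j (j+1)` (family `F_j`, rate `j`, action `𝒱_{j+1}`);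
k3c5-p3's `…TwoVolumeSourceReadoutAt.klSrcPinnedSum_two_two_le_of_sourceProfilesAtLev` pays the same datum from it at `(J, r, n) = (n_β, n_β, n_β + 1)`.
This file is the two doors with that antecedent, proofs byte-identical but for the extraction line:

* `stub_vl_nestedFramed_of_gluedSrcDefect_lev`, **`stub_vl_nestedFramed_of_gluedSrcDefect_keyedAt_lev`**.

Proofs only; no definition; nothing asserts the producer statement, the stub, K3 or superconductivity.
-/

noncomputable section

namespace Summit.HubbardSuperconductivity.HubbardSuperconductivity.Theorems.TwoPointAssembly

set_option linter.dupNamespace false -- summit = problem name (single-conjunct summit), D-0017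

open Finset Filter Topology Complex Literature.MathematicalPhysics.QuantumLattice Literature.Probability.LatticeModels GrassmannAlgebra
open Summit.HubbardSuperconductivity.HubbardSuperconductivity.Theorems.KLRegimeSplit
open Summit.HubbardSuperconductivity.HubbardSuperconductivity.Theorems.KLProgrammeLegKernels
open Summit.HubbardSuperconductivity.HubbardSuperconductivity.Theorems.EngineV8
open Summit.HubbardSuperconductivity.HubbardSuperconductivity.Theorems.TwoVolumeDefect
open Summit.HubbardSuperconductivity.HubbardSuperconductivity.Theorems.TwoVolumeSource

/-- **(v10) THE STUB `stub_vl_nestedFramed` FROM THE GLUED PINNED DEFECT ON SOURCE-PAIR STRINGS AT A DEEP FINE PIN** (e-free, ∃-pin; token #24 for BOTH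
volumes read from the stub's own hypothesis).  The conclusion is the registered type of `…KLRegimeVolumeLimitV17F2.stub_vl_nestedFramed` in skeleton «cauchy»
v9 (831d58cbda4d66f6). [cite: BenfattoGiulianiMastropietro2006, §2.9 (4.3)-(4.6)] -/
theorem stub_vl_nestedFramed_of_gluedSrcDefect_lev
    (hGlued : ∀ (G : GeoConsts) (P : SplitConsts) (Q : EngConsts) (R : RenConsts), G.WF → P.WF → Q.WF → R.WF →
      ∃ c₅ : ℝ, 0 < c₅ ∧ ∀ c : ℝ, 0 < c → c ≤ c₅ → ∃ U₀ : ℝ, 0 < U₀ ∧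
        ∀ μ ∈ klWindowC, ∀ U : ℝ, 0 < U → U ≤ U₀ → ∀ β : ℝ, klBetaMin ≤ β → β ≤ Real.exp (c / U ^ 2) →
          ∀ K : TrigPolyC4v, klPredsV17F2.frameOK R U (nScales β) μ K →
            ∀ (Lstar : ℕ) (Mstar : ℕ → ℕ), TowerP klPredsV17F2 G P Q R β U μ K Lstar Mstar →
              ∃ L₀ : ℕ, ∃ δ : ℕ → ℝ, Tendsto δ atTop (𝓝 0) ∧ ∃ Rd : ℕ → ℕ, Tendsto Rd atTop atTop ∧
                ∀ (L : ℕ) [NeZero L], L₀ ≤ L → ∀ (L'' : ℕ) [NeZero L''] (b : ℕ), L'' = b * L → ∃ M₀ : ℕ, ∀ (M : ℕ) [NeZero M], M₀ ≤ M →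
                  ∃ of : SpaceTimeIdx L'' M, (∀ j, Rd L ≤ (of.2 j).val % L ∧ (of.2 j).val % L + Rd L < L) ∧
                    2 * imagTimeWeight β M *
                      (∑ X ∈ univ.filter (fun X : Fin 2 → SrcLabel L'' M (nScales β + 1) => X 0 = ((of, ((⟨0, sectorCount_pos _⟩, 0), 0)), 1) ∧ (X 1).2 = 1),
                        ‖kernel ℂ (srcTrunc ℂ (fun Y : SrcLabel L'' M (nScales β + 1) => Y.2 = 1) 3
                              (klSrcAction L'' M β U μ (klFlowFrameU L'' M β U μ (nScales β + 1)) (nScales β + 1))) 2 X -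
                            (if ∀ i j, ((X i).1.1.2 j).val / L = ((X 0).1.1.2 j).val / L then
                              kernel ℂ (srcTrunc ℂ (fun Y : SrcLabel L M (nScales β + 1) => Y.2 = 1) 3
                                (klSrcAction L M β U μ (klFlowFrameU L M β U μ (nScales β + 1)) (nScales β + 1))) 2
                                (fun i => ((((X i).1.1.1, fun j => ((((X i).1.1.2 j).val : ℕ) : ZMod L)), (X i).1.2), (X i).2))
                            else 0)‖) ≤ δ L) :
    (∀ (P : SplitConsts) (R : RenConsts), P.WF → R.WF2 →
      ∃ Q' : EngConsts, 0 ≤ Q'.CE ∧ ∃ c₀ : ℝ, 0 < c₀ ∧ ∀ c : ℝ, 0 < c → c ≤ c₀ → ∃ U₀ : ℝ, 0 < U₀ ∧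
        ∀ μ ∈ klWindowC, ∀ U : ℝ, 0 < U → U ≤ U₀ → ∀ β : ℝ, klBetaMin ≤ β → β ≤ Real.exp (c / U ^ 2) →
          ∃ A : ℕ → ℕ → ℝ, ∃ L₁ : ℕ, ∃ M₁ : ℕ → ℕ, ∀ (L M : ℕ) [NeZero L] [NeZero M], L₁ ≤ L → M₁ L ≤ M →
            ∀ j : ℕ, j + 1 ≤ nScales β + 1 →
              SourceProfilesAtLev L M (klSrcBudget P Q' U A (j + 1)) β U μ (klFlowFrameU L M β U μ (nScales β + 1)) j j (j + 1)) →
    ∀ (G : GeoConsts) (P : SplitConsts) (Q : EngConsts) (R : RenConsts), G.WF → P.WF → Q.WF → R.WF →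
      ∃ c₅ : ℝ, 0 < c₅ ∧ ∀ c : ℝ, 0 < c → c ≤ c₅ → ∃ U₀ : ℝ, 0 < U₀ ∧
        ∀ μ ∈ klWindowC, ∀ U : ℝ, 0 < U → U ≤ U₀ → ∀ β : ℝ, klBetaMin ≤ β → β ≤ Real.exp (c / U ^ 2) →
          ∀ K : TrigPolyC4v, klPredsV17F2.frameOK R U (nScales β) μ K →
            ∀ (Lstar : ℕ) (Mstar : ℕ → ℕ), TowerP klPredsV17F2 G P Q R β U μ K Lstar Mstar →
              ∀ n : ℤ, ∃ L₀ : ℕ, ∃ ρ : ℕ → ℝ, Tendsto ρ atTop (𝓝 0) ∧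
                ∀ (L : ℕ) [NeZero L], L₀ ≤ L → ∀ (L'' : ℕ) [NeZero L''], L ∣ L'' → ∃ M₀ : ℕ, ∀ (M : ℕ) [NeZero M], M₀ ≤ M →
                  ∀ (ω : MatsubaraIdx M), matsubaraInt M ω = n → ∀ (k : TorusSite 2 L) (k'' : TorusSite 2 L''),
                    latticeMomentum L'' k'' = latticeMomentum L k →
                      ‖klSelfEnergy L M β U μ (klFlowFrameU L M β U μ (nScales β + 1)) klE0 (nScales β + 1) (ω, k) 0 -
                          klSelfEnergy L'' M β U μ (klFlowFrameU L'' M β U μ (nScales β + 1)) klE0 (nScales β + 1) (ω, k'') 0‖ ≤ ρ L := by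
  intro hSrc G P Q R hG hP hQ hR
  -- token #24 at `(P, R₁)`, `R₁ = ⟨1, 1, 1⟩` well-formed; thresholds shared by `min` / `max`
  have hR₁ : (⟨1, 1, fun _ => 1⟩ : RenConsts).WF2 := ⟨⟨zero_le_one, zero_le_one, fun _ => zero_le_one⟩, one_pos, one_pos⟩
  refine framedNestedFlowTextV17F2_of_srcActionGluedSrcDefect_srcPinnedSums ?_ G P Q R hG hP hQ hR
  intro G P Q R hG hP hQ hR
  obtain ⟨Q'', -, c₀', hc₀', hS'⟩ := hSrc P ⟨1, 1, fun _ => 1⟩ hP hR₁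
  obtain ⟨c₅, hc₅, hN⟩ := hGlued G P Q R hG hP hQ hR
  refine ⟨min c₅ c₀', lt_min hc₅ hc₀', fun c hc0 hcc => ?_⟩
  obtain ⟨U₁, hU₁, hN1⟩ := hN c hc0 (hcc.trans (min_le_left _ _))
  obtain ⟨U₂, hU₂, hS2⟩ := hS' c hc0 (hcc.trans (min_le_right _ _))
  refine ⟨min U₁ U₂, lt_min hU₁ hU₂, fun μ hμ U hU0 hUU β hβmin hβmax K hK Lstar Mstar hT => ?_⟩
  obtain ⟨L₀, δ, hδ, Rd, hRd, hLn⟩ := hN1 μ hμ U hU0 (hUU.trans (min_le_left _ _)) β hβmin hβmax K hK Lstar Mstar hT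
  obtain ⟨A, L₁, M₁, hA⟩ := hS2 μ hμ U hU0 (hUU.trans (min_le_right _ _)) β hβmin hβmax
  refine ⟨max L₀ L₁, δ, A (nScales β + 1) 2, hδ, Rd, hRd, fun L _ hL L'' _ b hb => ?_⟩
  obtain ⟨M₀, hM₀⟩ := hLn L ((le_max_left _ _).trans hL) L'' b hb
  have hLL'' : L ≤ L'' := Nat.le_of_dvd (Nat.pos_of_ne_zero (NeZero.ne L'')) ⟨b, by rw [hb, mul_comm]⟩
  have hL₁ : L₁ ≤ L := (le_max_right _ _).trans hL
  have hL₁'' : L₁ ≤ L'' := hL₁.trans hLL''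
  refine ⟨max M₀ (max (M₁ L) (M₁ L'')), fun M _ hM => ?_⟩
  obtain ⟨of, hof, hglued⟩ := hM₀ M ((le_max_left _ _).trans hM)
  have hβ0 : 0 ≤ β := (pos_of_klBetaMin_le hβmin).le
  exact ⟨of, hof, hglued,
    klSrcPinnedSum_two_two_le_of_sourceProfilesAtLev hβ0 (Nat.le_succ _)
      (hA L'' M hL₁'' ((le_max_right _ _).trans ((le_max_right _ _).trans hM)) (nScales β) le_rfl) of 0 0,
    klSrcPinnedSum_two_two_le_of_sourceProfilesAtLev hβ0 (Nat.le_succ _)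
      (hA L M hL₁ ((le_max_left _ _).trans ((le_max_right _ _).trans hM)) (nScales β) le_rfl) _ 0 0⟩

/-- **(v10) THE STUB FROM THE SPINE'S LAST OBJECT** (blueprint v5 §1 TOP / §3): the keyed block-reduced defect of the pair
`X_V = srcTrunc 3 (map (toLin' (ε • klSrcAnalysisAt V M β μ K_V J)) 𝒱_{n⋆}[K_V])` (`V = L″, L`; any alive index `J`; `ε = imagTimeWeight β M`) summed over the
SOURCE-PAIR strings at an `(Rd L)`-deep source pin, normalised as the spine tracks it (`2ε⁻¹·GLUED_ε ≤ δ L`), closes the registered `stub_vl_nestedFramed`.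
[cite: BenfattoGiulianiMastropietro2006, §2.9 (4.3)-(4.6)] -/
theorem stub_vl_nestedFramed_of_gluedSrcDefect_keyedAt_lev
    (hGlued : ∀ (G : GeoConsts) (P : SplitConsts) (Q : EngConsts) (R : RenConsts), G.WF → P.WF → Q.WF → R.WF →
      ∃ c₅ : ℝ, 0 < c₅ ∧ ∀ c : ℝ, 0 < c → c ≤ c₅ → ∃ U₀ : ℝ, 0 < U₀ ∧
        ∀ μ ∈ klWindowC, ∀ U : ℝ, 0 < U → U ≤ U₀ → ∀ β : ℝ, klBetaMin ≤ β → β ≤ Real.exp (c / U ^ 2) →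
          ∀ K : TrigPolyC4v, klPredsV17F2.frameOK R U (nScales β) μ K →
            ∀ (Lstar : ℕ) (Mstar : ℕ → ℕ), TowerP klPredsV17F2 G P Q R β U μ K Lstar Mstar →
              ∃ L₀ : ℕ, ∃ δ : ℕ → ℝ, Tendsto δ atTop (𝓝 0) ∧ ∃ Rd : ℕ → ℕ, Tendsto Rd atTop atTop ∧
                ∀ (L : ℕ) [NeZero L], L₀ ≤ L → ∀ (L'' : ℕ) [NeZero L''] (b : ℕ), L'' = b * L → ∃ M₀ : ℕ, ∀ (M : ℕ) [NeZero M], M₀ ≤ M →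
                  ∃ (J : ℕ) (e : (SpaceTimeIdx L'' M × SectorLeg (sectorCount J)) ≃ (Fin 2 → Fin b) × (SpaceTimeIdx L M × SectorLeg (sectorCount J)))
                    (ed : SrcLabel L'' M J ≃ (Fin 2 → Fin b) × SrcLabel L M J),
                    (∀ X' i, ((e X').1 i : ℕ) = (X'.1.2 i).val / L) ∧
                    (∀ X', (e X').2 = ((X'.1.1, fun i => (((X'.1.2 i).val : ℕ) : ZMod L)), X'.2)) ∧
                    (∀ x s, ed (x, s) = ((e x).1, ((e x).2, s))) ∧
                  ∃ of : SpaceTimeIdx L'' M, (∀ j, Rd L ≤ (of.2 j).val % L ∧ (of.2 j).val % L + Rd L < L) ∧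
                    2 * (imagTimeWeight β M)⁻¹ *
                      (∑ X ∈ univ.filter (fun X : Fin 2 → SrcLabel L'' M J => X 0 = ((of, ((⟨0, sectorCount_pos _⟩, 0), 0)), 1) ∧ (X 1).2 = 1),
                        ‖kernel ℂ (srcTrunc ℂ (fun Y : SrcLabel L'' M J => Y.2 = 1) 3
                              (ExteriorAlgebra.map (Matrix.toLin' (((imagTimeWeight β M : ℝ) : ℂ) •
                                  klSrcAnalysisAt L'' M β μ (klFlowFrameU L'' M β U μ (nScales β + 1)) J))
                                (klEffectiveAction L'' M β U μ (klFlowFrameU L'' M β U μ (nScales β + 1)) klE0 (nScales β + 1)))) 2 X -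
                            (if ∀ i, (ed (X i)).1 = (ed (X 0)).1 then
                              kernel ℂ (srcTrunc ℂ (fun Y : SrcLabel L M J => Y.2 = 1) 3
                                (ExteriorAlgebra.map (Matrix.toLin' (((imagTimeWeight β M : ℝ) : ℂ) •
                                    klSrcAnalysisAt L M β μ (klFlowFrameU L M β U μ (nScales β + 1)) J))
                                  (klEffectiveAction L M β U μ (klFlowFrameU L M β U μ (nScales β + 1)) klE0 (nScales β + 1)))) 2
                                (fun i => (ed (X i)).2)
                            else 0)‖) ≤ δ L) :
    (∀ (P : SplitConsts) (R : RenConsts), P.WF → R.WF2 →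
      ∃ Q' : EngConsts, 0 ≤ Q'.CE ∧ ∃ c₀ : ℝ, 0 < c₀ ∧ ∀ c : ℝ, 0 < c → c ≤ c₀ → ∃ U₀ : ℝ, 0 < U₀ ∧
        ∀ μ ∈ klWindowC, ∀ U : ℝ, 0 < U → U ≤ U₀ → ∀ β : ℝ, klBetaMin ≤ β → β ≤ Real.exp (c / U ^ 2) →
          ∃ A : ℕ → ℕ → ℝ, ∃ L₁ : ℕ, ∃ M₁ : ℕ → ℕ, ∀ (L M : ℕ) [NeZero L] [NeZero M], L₁ ≤ L → M₁ L ≤ M →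
            ∀ j : ℕ, j + 1 ≤ nScales β + 1 →
              SourceProfilesAtLev L M (klSrcBudget P Q' U A (j + 1)) β U μ (klFlowFrameU L M β U μ (nScales β + 1)) j j (j + 1)) →
    ∀ (G : GeoConsts) (P : SplitConsts) (Q : EngConsts) (R : RenConsts), G.WF → P.WF → Q.WF → R.WF →
      ∃ c₅ : ℝ, 0 < c₅ ∧ ∀ c : ℝ, 0 < c → c ≤ c₅ → ∃ U₀ : ℝ, 0 < U₀ ∧
        ∀ μ ∈ klWindowC, ∀ U : ℝ, 0 < U → U ≤ U₀ → ∀ β : ℝ, klBetaMin ≤ β → β ≤ Real.exp (c / U ^ 2) →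
          ∀ K : TrigPolyC4v, klPredsV17F2.frameOK R U (nScales β) μ K →
            ∀ (Lstar : ℕ) (Mstar : ℕ → ℕ), TowerP klPredsV17F2 G P Q R β U μ K Lstar Mstar →
              ∀ n : ℤ, ∃ L₀ : ℕ, ∃ ρ : ℕ → ℝ, Tendsto ρ atTop (𝓝 0) ∧
                ∀ (L : ℕ) [NeZero L], L₀ ≤ L → ∀ (L'' : ℕ) [NeZero L''], L ∣ L'' → ∃ M₀ : ℕ, ∀ (M : ℕ) [NeZero M], M₀ ≤ M →
                  ∀ (ω : MatsubaraIdx M), matsubaraInt M ω = n → ∀ (k : TorusSite 2 L) (k'' : TorusSite 2 L''),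
                    latticeMomentum L'' k'' = latticeMomentum L k →
                      ‖klSelfEnergy L M β U μ (klFlowFrameU L M β U μ (nScales β + 1)) klE0 (nScales β + 1) (ω, k) 0 -
                          klSelfEnergy L'' M β U μ (klFlowFrameU L'' M β U μ (nScales β + 1)) klE0 (nScales β + 1) (ω, k'') 0‖ ≤ ρ L := by
  refine stub_vl_nestedFramed_of_gluedSrcDefect_lev fun G P Q R hG hP hQ hR => ?_
  obtain ⟨c₅, hc₅, hc⟩ := hGlued G P Q R hG hP hQ hR
  refine ⟨c₅, hc₅, fun c hc0 hcc => ?_⟩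
  obtain ⟨U₀, hU₀, hU⟩ := hc c hc0 hcc
  refine ⟨U₀, hU₀, fun μ hμ U hU0 hUU β hβmin hβmax K hK Lstar Mstar hT => ?_⟩
  have hβ : 0 < β := pos_of_klBetaMin_le hβmin
  obtain ⟨L₀, δ, hδ, Rd, hRd, hDn⟩ := hU μ hμ U hU0 hUU β hβmin hβmax K hK Lstar Mstar hT
  refine ⟨L₀, δ, hδ, Rd, hRd, fun L _ hL L'' _ b hb => ?_⟩
  obtain ⟨M₀, hM₀⟩ := hDn L hL L'' b hb
  refine ⟨M₀, fun M _ hM => ?_⟩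
  obtain ⟨J, e, ed, he1, he2, hed, of, hof, hglued⟩ := hM₀ M hM
  refine ⟨of, hof, ?_⟩
  -- `ε > 0`, and `2ε·S_n = 2ε⁻¹·(ε²·S_n) ≤ 2ε⁻¹·S_J(e-free) = 2ε⁻¹·S_J(keyed) ≤ δ L`
  have hMpos : (0 : ℝ) < M := Nat.cast_pos.2 (Nat.pos_of_ne_zero (NeZero.ne M))
  have hε : 0 < imagTimeWeight β M := by unfold imagTimeWeight; positivity
  have hsq : ‖((imagTimeWeight β M : ℝ) : ℂ)‖ ^ 2 = imagTimeWeight β M ^ 2 := by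
    rw [Complex.norm_real, Real.norm_of_nonneg hε.le]
  have hcmp := sq_mul_srcPairSum_le_srcPairSumAt (L := L) ((imagTimeWeight β M : ℝ) : ℂ) β U μ
    (klFlowFrameU L M β U μ (nScales β + 1)) (klFlowFrameU L'' M β U μ (nScales β + 1)) J (nScales β + 1) of 0 0
  rw [hsq] at hcmp
  refine le_trans ?_ hglued
  have hkey : ∀ X : Fin 2 → SrcLabel L'' M J,
      (if ∀ i, (ed (X i)).1 = (ed (X 0)).1 then
          kernel ℂ (srcTrunc ℂ (fun Y : SrcLabel L M J => Y.2 = 1) 3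
            (ExteriorAlgebra.map (Matrix.toLin' (((imagTimeWeight β M : ℝ) : ℂ) •
                klSrcAnalysisAt L M β μ (klFlowFrameU L M β U μ (nScales β + 1)) J))
              (klEffectiveAction L M β U μ (klFlowFrameU L M β U μ (nScales β + 1)) klE0 (nScales β + 1)))) 2 (fun i => (ed (X i)).2)
        else 0) =
      if ∀ i j, ((X i).1.1.2 j).val / L = ((X 0).1.1.2 j).val / L then
          kernel ℂ (srcTrunc ℂ (fun Y : SrcLabel L M J => Y.2 = 1) 3
            (ExteriorAlgebra.map (Matrix.toLin' (((imagTimeWeight β M : ℝ) : ℂ) •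
                klSrcAnalysisAt L M β μ (klFlowFrameU L M β U μ (nScales β + 1)) J))
              (klEffectiveAction L M β U μ (klFlowFrameU L M β U μ (nScales β + 1)) klE0 (nScales β + 1)))) 2
            (fun i => ((((X i).1.1.1, fun j => ((((X i).1.1.2 j).val : ℕ) : ZMod L)), (X i).1.2), (X i).2))
        else 0 := fun X => keyedReduced_eq_ite e ed he1 he2 hed _ 0 X
  simp only [hkey]
  calc 2 * imagTimeWeight β M * _ = 2 * (imagTimeWeight β M)⁻¹ * (imagTimeWeight β M ^ 2 * _) := two_mul_eps_eq _ _ hε.ne'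
    _ ≤ 2 * (imagTimeWeight β M)⁻¹ * _ := mul_le_mul_of_nonneg_left hcmp (by positivity)

end Summit.HubbardSuperconductivity.HubbardSuperconductivity.Theorems.TwoPointAssembly

end
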